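import Summits.MatrixMultiplication.MatrixMultiplication.Theorems.LevelOneGL2Designs.Negative.LevelSpace

/-!
# Negative lemmas for the crux `LevelOneGL2Designs` (stmt-MatrixMultiplication-14080), part R:
the torus RECTANGLE relation and the template kill it yields

Refuter-side (cdisprove) analysis; no theorem asserts a Theses statement positively.
* `rectangle_orth` — ideator 2's RECTANGLE RELATION (crux-ideate round 1, card
  torus-rectangle-relations; stated with `sorry` in `Cruxes/LevelOneGL2Designs/Ideator2Sketch.lean`,
  PROVED here in a verbatim vocabulary): for `a, a', d, d' ≠ 0` the signed indicator of the four
  cosets `diag(a,d)U⁺, diag(a,d')U⁺, diag(a',d)U⁺, diag(a',d')U⁺` (signs `+ − − +`) is orthogonal to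
  every level-one test function of `GL_2(𝔽_p)`:
  `Σ_N rect(N)ψ(tr(MN)) = (Σ_x ψ(M₁₀x))·(ψ(M₀₀a) − ψ(M₀₀a'))(ψ(M₁₁d) − ψ(M₁₁d'))`, and for
  `rk M ≤ 1` with `M₁₀ = 0` one has `M₀₀M₁₁ = det M = 0`.
* `not_rankSep_of_torus_rectangle` — TEMPLATE KILL for every `p` and every middle set: `1 ∈ X`,
  some `x₁ ∈ X` with `x₁⁻¹ = diag(a',1)`, `Y ≠ ∅`, `Z ⊇ U⁺ ∪ diag(1,d')U⁺` (`a', d' ∉ {0,1}`) ⇒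
  `(X,Y,Z)` is NOT rank-1-separated (the quadruple products contain the rectangle `{1,a'}×{1,d'}`
  through the target `1`).  Kills the subgroup template `(U⁻⋊C₁, K', U⁺⋊C₃)` with
  `|C₁|, |C₃| ≥ 2` (confirmed numerically by kit j011883, j012178, j012241).
-/

noncomputable section

namespace Summit.MatrixMultiplication.MatrixMultiplication.Theorems.LevelOneGL2Designs.Negative

open Summit.MatrixMultiplication.MatrixMultiplication.Theses.LevelGradedCohnUmans
open Summit.MatrixMultiplication.MatrixMultiplication.Theorems.LieRankDesigns.Negative
variable {p : ℕ}

/-! ## THE RECTANGLE RELATION (ideator 2's `rectangle_orth`, PROVED here) -/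

section Rectangle

variable {p : ℕ} [Fact p.Prime]

/-- The upper-triangular matrix `[[s, x], [0, t]]`. -/
def triU (s t x : ZMod p) : Mat p 2 := !![s, x; 0, t]

/-- `x ↦ [[s,x],[0,t]]` is injective. -/
theorem triU_injective (s t : ZMod p) : Function.Injective (triU s t) := by
  intro x y h
  have := congrFun (congrFun h 0) 1
  simpa [triU] using this

/-- Indicator of the coset piece `{N : N₁₀ = 0, N₀₀ = s, N₁₁ = t}` (as matrices). -/
def ind (s t : ZMod p) (N : Mat p 2) : ℂ :=
  if N 1 0 = 0 ∧ N 0 0 = s ∧ N 1 1 = t then 1 else 0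

/-- **One coset, one character**: `Σ_{N ∈ diag(s,t)U⁺} ψ(tr(M N)) = ψ(M₀₀ s + M₁₁ t) · Σ_x ψ(M₁₀ x)`. -/
theorem sum_ind_mul_psi (M : Mat p 2) (s t : ZMod p) :
    ∑ N : Mat p 2, ind s t N * ZMod.stdAddChar (Matrix.trace (M * N))
      = ZMod.stdAddChar (M 0 0 * s + M 1 1 * t) * ∑ x : ZMod p, ZMod.stdAddChar (M 1 0 * x) := by
  classical
  have h1 : ∑ N : Mat p 2, ind s t N * ZMod.stdAddChar (Matrix.trace (M * N))
      = ∑ N ∈ Finset.univ.filter (fun N : Mat p 2 => N 1 0 = 0 ∧ N 0 0 = s ∧ N 1 1 = t),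
          ZMod.stdAddChar (Matrix.trace (M * N)) := by
    rw [Finset.sum_filter]
    refine Finset.sum_congr rfl fun N _ => ?_
    unfold ind
    split_ifs <;> simp
  have hfilter : Finset.univ.filter (fun N : Mat p 2 => N 1 0 = 0 ∧ N 0 0 = s ∧ N 1 1 = t)
      = Finset.univ.image (triU s t) := by
    ext N
    simp only [Finset.mem_filter, Finset.mem_univ, true_and, Finset.mem_image]
    constructor
    · rintro ⟨h10, h00, h11⟩
      refine ⟨N 0 1, ?_⟩
      ext i j
      fin_cases i <;> fin_cases j <;> simp [triU, h10, h00, h11]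
    · rintro ⟨x, rfl⟩
      simp [triU]
  rw [h1, hfilter]
  have hinj : ∀ x ∈ (Finset.univ : Finset (ZMod p)), ∀ y ∈ (Finset.univ : Finset (ZMod p)),
      triU s t x = triU s t y → x = y := fun x _ y _ h => triU_injective s t h
  rw [Finset.sum_image hinj, Finset.mul_sum]
  refine Finset.sum_congr rfl fun x _ => ?_
  rw [← AddChar.map_add_eq_mul]
  congr 1
  have htr : Matrix.trace (M * triU s t x) = M 0 0 * s + M 1 0 * x + M 1 1 * t := by
    simp [triU, Matrix.trace_fin_two, Matrix.mul_apply, Fin.sum_univ_two]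
    ring
  rw [htr]
  ring

/-- Ideator 2's `rectangle` (verbatim copy of `Cruxes/LevelOneGL2Designs/Ideator2Sketch.lean`, which is
not imported here to keep this file independent of a sketch that is still moving): the signed
indicator `+1` on `diag(a,d)U⁺ ∪ diag(a',d')U⁺`, `−1` on `diag(a,d')U⁺ ∪ diag(a',d)U⁺`. -/
def rectangle (a a' d d' : ZMod p) (g : GLm p 2) : ℂ :=
  if (g : Mat p 2) 1 0 = 0 then
    (if (g : Mat p 2) 0 0 = a ∧ (g : Mat p 2) 1 1 = d then 1 else 0)
    - (if (g : Mat p 2) 0 0 = a ∧ (g : Mat p 2) 1 1 = d' then 1 else 0)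
    - (if (g : Mat p 2) 0 0 = a' ∧ (g : Mat p 2) 1 1 = d then 1 else 0)
    + (if (g : Mat p 2) 0 0 = a' ∧ (g : Mat p 2) 1 1 = d' then 1 else 0)
  else 0

/-- The rectangle as a combination of four coset indicators, on matrices. -/
def rectM (a a' d d' : ZMod p) (N : Mat p 2) : ℂ :=
  ind a d N - ind a d' N - ind a' d N + ind a' d' N

/-- `rectangle` is `rectM` read on the underlying matrix. -/
theorem rectangle_eq_rectM (a a' d d' : ZMod p) (g : GLm p 2) :
    rectangle a a' d d' g = rectM a a' d d' (g : Mat p 2) := by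
  unfold rectangle rectM ind
  by_cases h : (g : Mat p 2) 1 0 = 0
  · simp [h]
  · simp [h]

/-- **The signed character sum of a rectangle vanishes for every matrix of rank `≤ 1`.**
`Σ_N rectM(N) ψ(tr(M N)) = (Σ_x ψ(M₁₀x)) · (ψ(M₀₀a) − ψ(M₀₀a'))(ψ(M₁₁d) − ψ(M₁₁d'))`: the first factor
vanishes unless `M₁₀ = 0`, and then `det M = M₀₀M₁₁ = 0` kills one of the other two. -/
theorem sum_rectM_mul_psi_eq_zero {M : Mat p 2} (hM : M.rank ≤ 1) (a a' d d' : ZMod p) :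
    ∑ N : Mat p 2, rectM a a' d d' N * ZMod.stdAddChar (Matrix.trace (M * N)) = 0 := by
  classical
  have hsplit : ∑ N : Mat p 2, rectM a a' d d' N * ZMod.stdAddChar (Matrix.trace (M * N))
      = (∑ x : ZMod p, ZMod.stdAddChar (M 1 0 * x)) *
        ((ZMod.stdAddChar (M 0 0 * a) - ZMod.stdAddChar (M 0 0 * a')) *
         (ZMod.stdAddChar (M 1 1 * d) - ZMod.stdAddChar (M 1 1 * d'))) := by
    simp only [rectM, sub_mul, add_mul, Finset.sum_add_distrib, Finset.sum_sub_distrib,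
      sum_ind_mul_psi, AddChar.map_add_eq_mul]
    ring
  rw [hsplit]
  by_cases h10 : M 1 0 = 0
  · -- det M = M₀₀ M₁₁ = 0
    have hdet : M.det = 0 := (rank_le_one_iff_det_eq_zero M).mp hM
    rw [Matrix.det_fin_two, h10, mul_zero, sub_zero] at hdet
    rcases mul_eq_zero.mp hdet with h00 | h11
    · simp [h00]
    · simp [h11]
  · have h := AddChar.sum_mulShift (R := ZMod p) (M 1 0) (ZMod.isPrimitive_stdAddChar p)
    rw [if_neg h10] at h
    simp_rw [mul_comm _ (M 1 0)] at h
    rw [h]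
    simp

/-- `rectM` vanishes on singular matrices when `a, a', d, d' ≠ 0`. -/
theorem rectM_eq_zero_of_not_isUnit {a a' d d' : ZMod p} (ha : a ≠ 0) (ha' : a' ≠ 0) (hd : d ≠ 0)
    (hd' : d' ≠ 0) {N : Mat p 2} (hN : ¬ IsUnit N) : rectM a a' d d' N = 0 := by
  have key : ∀ s t : ZMod p, s ≠ 0 → t ≠ 0 → ind s t N = 0 := by
    intro s t hs ht
    unfold ind
    rw [if_neg]
    rintro ⟨h10, h00, h11⟩
    apply hN
    rw [Matrix.isUnit_iff_isUnit_det, Matrix.det_fin_two, h10, h00, h11, mul_zero, sub_zero]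
    exact isUnit_iff_ne_zero.mpr (mul_ne_zero hs ht)
  simp [rectM, key a d ha hd, key a d' ha hd', key a' d ha' hd, key a' d' ha' hd']

/-- Sums over `GL_2` of functions vanishing on singular matrices are sums over all matrices. -/
theorem sum_GL_eq_sum_mat (F : Mat p 2 → ℂ) (hF : ∀ N, ¬ IsUnit N → F N = 0) :
    ∑ g : GLm p 2, F (g : Mat p 2) = ∑ N : Mat p 2, F N := by
  classical
  rw [← Finset.sum_filter_of_ne (s := (Finset.univ : Finset (Mat p 2))) (p := IsUnit)
      (fun N _ hne => by_contra fun h => hne (hF N h))]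
  refine Finset.sum_nbij (fun g : GLm p 2 => (g : Mat p 2)) (fun g _ => by simp)
    (fun g _ g' _ h => Units.ext h) ?_ (fun _ _ => rfl)
  intro N hN
  simp only [Finset.coe_filter, Finset.mem_univ, true_and, Set.mem_setOf_eq] at hN
  obtain ⟨u, rfl⟩ := hN
  exact ⟨u, by simp⟩

/-- **RECTANGLE RELATION (ideator 2's `rectangle_orth`, PROVED here).**  For `a, a', d, d'` non-zero the
signed indicator of the four cosets `diag(a,d)U⁺, diag(a,d')U⁺, diag(a',d)U⁺, diag(a',d')U⁺` (signs
`+ − − +`) is orthogonal to every level-one test function.  (`a ≠ a'`, `d ≠ d'` are not needed for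
orthogonality — only for the relation to be non-zero.)  Since `rectangle`, `RankSupp`, `fourierFn`
here are character-for-character the defs of `Ideator2Sketch.lean`, this term closes that file's
`sorry` verbatim. -/
theorem rectangle_orth {a a' d d' : ZMod p} (ha : a ≠ 0) (ha' : a' ≠ 0) (hd : d ≠ 0) (hd' : d' ≠ 0) :
    ∀ c : Mat p 2 → ℂ, RankSupp 1 c →
      ∑ g : GLm p 2, rectangle a a' d d' g * fourierFn c g = 0 := by
  classical
  intro c hc
  simp_rw [rectangle_eq_rectM]
  calc ∑ g : GLm p 2, rectM a a' d d' (g : Mat p 2) * fourierFn c g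
      = ∑ g : GLm p 2, ∑ M : Mat p 2,
          c M * (rectM a a' d d' (g : Mat p 2) * ZMod.stdAddChar (Matrix.trace (M * (g : Mat p 2)))) := by
        refine Finset.sum_congr rfl fun g _ => ?_
        rw [fourierFn, Finset.mul_sum]
        refine Finset.sum_congr rfl fun M _ => ?_
        ring
    _ = ∑ M : Mat p 2, c M * ∑ g : GLm p 2,
          rectM a a' d d' (g : Mat p 2) * ZMod.stdAddChar (Matrix.trace (M * (g : Mat p 2))) := by
        rw [Finset.sum_comm]
        refine Finset.sum_congr rfl fun M _ => ?_
        rw [Finset.mul_sum]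
    _ = 0 := by
        refine Finset.sum_eq_zero fun M _ => ?_
        by_cases hcM : c M = 0
        · rw [hcM, zero_mul]
        · have hM : M.rank ≤ 1 := le_of_not_gt fun h => hcM (hc M h)
          rw [sum_GL_eq_sum_mat (fun N => rectM a a' d d' N * ZMod.stdAddChar (Matrix.trace (M * N)))
              (fun N hN => by rw [rectM_eq_zero_of_not_isUnit ha ha' hd hd' hN, zero_mul]),
            sum_rectM_mul_psi_eq_zero hM, mul_zero]

/-- The invertible upper-triangular matrix `[[s, x], [0, t]]`, `s, t ≠ 0`, as an element of `GL_2`. -/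
def triGL (s t x : ZMod p) (hs : s ≠ 0) (ht : t ≠ 0) : GLm p 2 :=
  Matrix.GeneralLinearGroup.mkOfDetNeZero !![s, x; 0, t]
    (by rw [Matrix.det_fin_two_of]; simpa using mul_ne_zero hs ht)

/-- The underlying matrix of `triGL`. -/
@[simp] theorem triGL_val (s t x : ZMod p) (hs : s ≠ 0) (ht : t ≠ 0) :
    ((triGL s t x hs ht : GLm p 2) : Mat p 2) = !![s, x; 0, t] := rfl

/-- `triGL` depends only on its entries (proof arguments are irrelevant). -/
theorem triGL_congr {s s' t t' x x' : ZMod p} {hs : s ≠ 0} {ht : t ≠ 0} (hs' : s' ≠ 0)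
    (ht' : t' ≠ 0) (h1 : s = s') (h2 : t = t') (h3 : x = x') :
    triGL s t x hs ht = triGL s' t' x' hs' ht' := by
  subst h1 h2 h3; rfl

/-- Where the rectangle `{1,a'} × {1,d'}` is non-zero: lower-left entry `0`, diagonal in the rectangle. -/
theorem rectangle_support {a' d' : ZMod p} {g : GLm p 2} (hg : rectangle 1 a' 1 d' g ≠ 0) :
    (g : Mat p 2) 1 0 = 0 ∧ ((g : Mat p 2) 0 0 = 1 ∨ (g : Mat p 2) 0 0 = a') ∧
      ((g : Mat p 2) 1 1 = 1 ∨ (g : Mat p 2) 1 1 = d') := by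
  unfold rectangle at hg
  by_cases h10 : (g : Mat p 2) 1 0 = 0
  · refine ⟨h10, ?_, ?_⟩
    · by_contra h
      push Not at h
      apply hg
      simp [h10, h.1, h.2]
    · by_contra h
      push Not at h
      apply hg
      simp [h10, h.1, h.2]
  · exact absurd (by simp [h10]) hg

/-- **TWO TORUS DIRECTIONS AROUND FULL `U⁺`-COSETS KILL THE TARGET `1`** (ideator 2's template kill,
now a theorem).  If `1 ∈ X`, `X` contains an element with inverse `diag(a', 1)` (`a' ≠ 0, 1`), `Y ≠ ∅`,
and `Z ⊇ U⁺ ∪ diag(1, d')U⁺` (`d' ≠ 0, 1`), then `P = X⁻¹YY⁻¹Z` contains the rectangle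
`{1, a'} × {1, d'}` of `U⁺`-cosets through the target `1 = 1⁻¹·1`, and `(X, Y, Z)` is NOT
rank-1-separated — for every `p`, whatever the middle set.  Covers the whole subgroup template
`(U⁻⋊C₁, K', U⁺⋊C₃)` with `|C₁|, |C₃| ≥ 2` (the last subgroup shape the permutability theorem left
open) and `(Aff⁺, T₂, U⁻)` up to transpose. -/
theorem not_rankSep_of_torus_rectangle {X Y Z : Finset (GLm p 2)} {a' d' : ZMod p}
    (ha'0 : a' ≠ 0) (ha'1 : a' ≠ 1) (hd'0 : d' ≠ 0) (hd'1 : d' ≠ 1)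
    (h1X : (1 : GLm p 2) ∈ X) (hXa : ∃ x₁ ∈ X, ((x₁⁻¹ : GLm p 2) : Mat p 2) = !![a', 0; 0, 1])
    (hY : Y.Nonempty)
    (hZ1 : ∀ x : ZMod p, triGL 1 1 x one_ne_zero one_ne_zero ∈ Z)
    (hZd : ∀ x : ZMod p, triGL 1 d' x one_ne_zero hd'0 ∈ Z) :
    ¬ RankSep 1 X Y Z := by
  classical
  obtain ⟨y₀, hy₀⟩ := hY
  obtain ⟨x₁, hx₁, hx₁inv⟩ := hXa
  have h1Z : (1 : GLm p 2) ∈ Z := by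
    have h := hZ1 0
    have he : triGL 1 1 0 one_ne_zero one_ne_zero = (1 : GLm p 2) := by
      apply Units.ext
      rw [triGL_val]
      ext i j
      fin_cases i <;> fin_cases j <;> rfl
    rwa [he] at h
  -- every point of the rectangle is a quadruple product
  have hP : ∀ g : GLm p 2, rectangle 1 a' 1 d' g ≠ 0 → g ∈ quadProducts X Y Z := by
    intro g hg
    obtain ⟨h10, h00, h11⟩ := rectangle_support hg
    -- the diagonal entries
    set s := (g : Mat p 2) 0 0 with hs
    set t := (g : Mat p 2) 1 1 with ht
    have hs0 : s ≠ 0 := by rcases h00 with h | h <;> rw [h] <;> [exact one_ne_zero; exact ha'0]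
    have ht0 : t ≠ 0 := by rcases h11 with h | h <;> rw [h] <;> [exact one_ne_zero; exact hd'0]
    -- x with x⁻¹ = diag(s,1), z = [[1, g₀₁/s],[0,t]]
    obtain ⟨x, hx, hxinv⟩ : ∃ x ∈ X, ((x⁻¹ : GLm p 2) : Mat p 2) = !![s, 0; 0, 1] := by
      rcases h00 with h | h
      · exact ⟨1, h1X, by rw [inv_one, h]; ext i j; fin_cases i <;> fin_cases j <;> rfl⟩
      · exact ⟨x₁, hx₁, by rw [hx₁inv, h]⟩
    have hz : triGL 1 t ((g : Mat p 2) 0 1 / s) one_ne_zero ht0 ∈ Z := by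
      rcases h11 with h | h
      · rw [triGL_congr one_ne_zero one_ne_zero rfl h rfl]; exact hZ1 _
      · rw [triGL_congr one_ne_zero hd'0 rfl h rfl]; exact hZd _
    have hg_eq : g = x⁻¹ * y₀ * y₀⁻¹ * triGL 1 t ((g : Mat p 2) 0 1 / s) one_ne_zero ht0 := by
      rw [show x⁻¹ * y₀ * y₀⁻¹ * triGL 1 t ((g : Mat p 2) 0 1 / s) one_ne_zero ht0
          = x⁻¹ * triGL 1 t ((g : Mat p 2) 0 1 / s) one_ne_zero ht0 by group]
      apply Units.ext
      rw [Units.val_mul, hxinv, triGL_val]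
      ext i j
      fin_cases i <;> fin_cases j
      · simp [hs]
      · simp [Matrix.mul_apply, Fin.sum_univ_two]; field_simp
      · simp [Matrix.mul_apply, Fin.sum_univ_two, h10]
      · simp [Matrix.mul_apply, Fin.sum_univ_two, ht]
    rw [hg_eq]
    exact mem_quadProducts hx hy₀ hy₀ hz
  -- the separating function of the target (1,1) pairs to 0 with the rectangle, but the pairing is 1
  intro hsep
  obtain ⟨c, hc, hsepc⟩ := hsep 1 h1X 1 h1Z
  have hsum := rectangle_orth one_ne_zero ha'0 one_ne_zero hd'0 c hc
  have hval : ∀ g : GLm p 2, rectangle 1 a' 1 d' g * fourierFn c g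
      = if g = 1 then rectangle 1 a' 1 d' g else 0 := by
    intro g
    by_cases hρ : rectangle 1 a' 1 d' g = 0
    · simp [hρ]
    · rw [sep_apply_of_mem_quadProducts h1X h1Z hsepc (hP g hρ), inv_one, one_mul]
      by_cases hg1 : g = 1 <;> simp [hg1]
  simp_rw [hval] at hsum
  rw [Finset.sum_ite_eq'] at hsum
  simp only [Finset.mem_univ, if_true] at hsum
  -- rectangle at the identity is 1
  apply one_ne_zero (α := ℂ)
  rw [← hsum]
  unfold rectangle
  have e10 : ((1 : GLm p 2) : Mat p 2) 1 0 = 0 := by simp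
  have e00 : ((1 : GLm p 2) : Mat p 2) 0 0 = 1 := by simp
  have e11 : ((1 : GLm p 2) : Mat p 2) 1 1 = 1 := by simp
  rw [e10, e00, e11]
  simp [Ne.symm ha'1, Ne.symm hd'1]

end Rectangle
end Summit.MatrixMultiplication.MatrixMultiplication.Theorems.LevelOneGL2Designs.Negative

end
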